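import Summits.QuantumFields.YangMills.Theorems.LangevinControlUVFemtoCurvatureTwoPointStrictRPSliceLemma
import Summits.QuantumFields.YangMills.Theorems.LangevinControlUVFemtoCurvatureTwoPointStrictRPSiteTransferForm
import Summits.QuantumFields.YangMills.Theorems.LangevinControlUVFemtoCurvatureTwoPointMirrorPairs
import Summits.QuantumFields.YangMills.Theorems.LangevinControlUVFemtoCurvatureTwoPointAxisProfileAntitone

/-!
# Crux `FemtoCurvatureTwoPoint` (stmt-QuantumFields-9363, route `LangevinControlUV`):
# strict positivity of the axis covariance, VIII — the theorem on the even torus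

Helper for the registered sub-goal `stub_axisPositive` (`--supports stmt-QuantumFields-9363`):
for EVERY coupling `β > 0` (not only eventually), every even torus side `L ≥ 4`, every compact group
`G ≠ 1` and every continuous faithful unitary representation `ρ`,

  `Cov_{L,β}(P_0^{01}, P_{e₂}^{01}) > 0`  (`cruxAxisCov_one_pos_of_even`),

the crux's reference axis covariance. Route: the covariance of a spatial plaquette at time `1` with
its site mirror is `c · ‖χ‖²_{L²}` by reflection positivity through sites WITH EQUALITY
(`integral_siteRP_eq`, the tree's `LatticeRP.integral_splice_mul_conj_comp_of_shared`); if it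
vanished, the continuous slab functional `χ` would vanish identically, hence (part VII) the slice
kernel of the slice `t = 1` would annihilate `(Re tr ρ(W_q) − m) · restWeight`, contradicting the
slice lemma (part IV). So the site-mirror covariance is strictly positive
(`cov_negReflect_pair_pos`); transported to the crux's pair at separation `2` (tree: `cruxAxisCov_eq`,
`negReflect_single`, `cov_translate`) and lowered to separation `1` by the landed antitone axis
profile (`axisPlaquetteCov_antitone`). This is the strict form of Osterwalder–Seiler positivity
(Seiler LNP 159 Ch. 2: the transfer matrix is positive DEFINITE for a faithful representation) —
proved here without characters. Odd `L` is the companion file `…OddStrict`.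
-/

set_option autoImplicit false

noncomputable section

namespace Summit.QuantumFields.YangMills.Theorems.FemtoCurvatureTwoPoint.StrictRP

open MeasureTheory Finset
open scoped Matrix ComplexConjugate
open Literature.MathematicalPhysics.QuantumFieldTheory

section Main

variable {d L N : ℕ} [NeZero d] [NeZero L] [Fact (1 < L)] {G : Type*} [Group G]
  [TopologicalSpace G] [IsTopologicalGroup G] [CompactSpace G] [MeasurableSpace G] [BorelSpace G]
  (ρ : G →* Matrix (Fin N) (Fin N) ℂ)

/-- **Reflection positivity through sites, with equality.** For `L` even and `F` bounded
measurable depending on the closed positive half,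
`∫ e^{-βS(U)} conj F(Θ'U) F(U) dU = e^{-βN#plaq} ∫ χ_F(V) conj χ_F(V) dV` with the slab functional
`χ_F(V) = ∫ (F e^{βA' + βS_M/2})(splice_{P'}(V, W)) dW` (the tree's core identity
`LatticeRP.integral_splice_mul_conj_comp_of_shared`, assembled as in
`WilsonSiteRP.integral_siteIntegrand_nonneg`). [folklore] -/
theorem integral_siteRP_eq (hL : Even L) (hρ : Continuous ρ) (β : ℝ) {F : GaugeConfig d L G → ℂ}
    (hF : Measurable F) {CF : ℝ} (hFb : ∀ U, ‖F U‖ ≤ CF)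
    (hFdep : DependsOn F ((WilsonSiteRP.sitePosEdges ∪ WilsonSiteRP.sharedEdges : Finset (Edge d L)) :
      Set (Edge d L))) :
    ∫ U, (Real.exp (-β * wilsonAction ρ U) : ℂ) * (conj (F (GaugeConfig.negReflect U)) * F U)
        ∂(LatticeRP.piMeasure (ι := Edge d L) (haarProbability G)) =
      (Real.exp (-β * (N * Fintype.card (Plaquette d L))) : ℂ) *
        ∫ V, (∫ W, WilsonSiteRP.siteObs ρ β F (LatticeRP.splice WilsonSiteRP.sitePosEdges (V, W))
              ∂(LatticeRP.piMeasure (ι := Edge d L) (haarProbability G))) *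
          conj (∫ W, WilsonSiteRP.siteObs ρ β F (LatticeRP.splice WilsonSiteRP.sitePosEdges (V, W))
              ∂(LatticeRP.piMeasure (ι := Edge d L) (haarProbability G)))
          ∂(LatticeRP.piMeasure (ι := Edge d L) (haarProbability G)) := by
  simp_rw [WilsonSiteRP.siteIntegrand_eq ρ hL hρ β F]
  rw [integral_const_mul]
  congr 1
  have key := LatticeRP.integral_splice_mul_conj_comp_of_shared (haarProbability G)
    WilsonSiteRP.sharedEdges WilsonSiteRP.sitePosEdges (∅ : Finset (Edge d L)) GaugeConfig.negReflect
    WilsonSiteRP.measurePreserving_negReflect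
    (fun U e he => WilsonSiteRP.negReflect_apply_of_mem_sharedEdges hL U e he)
    (fun e he => WilsonSiteRP.dependsOn_negReflect_apply hL e he)
    WilsonSiteRP.disjoint_sharedEdges_sitePosEdges (Finset.disjoint_empty_right _)
    (WilsonSiteRP.measurable_siteObs ρ hρ β hF) (WilsonSiteRP.norm_siteObs_le ρ hρ β hFb)
    (WilsonSiteRP.dependsOn_siteObs ρ hL β hFdep)
  have hsplice : ∀ p : GaugeConfig d L G × GaugeConfig d L G,
      LatticeRP.splice (∅ : Finset (Edge d L)) p = p.1 := fun p => by
    funext i; simp [LatticeRP.splice_apply]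
  simp_rw [hsplice] at key
  rw [integral_fun_fst (fun U : GaugeConfig d L G =>
      WilsonSiteRP.siteObs ρ β F U * conj (WilsonSiteRP.siteObs ρ β F (GaugeConfig.negReflect U))),
    probReal_univ, one_smul] at key
  rw [key]
  simp only [Finset.union_empty]

omit [NeZero d] [Fact (1 < L)] in
/-- **A vanishing Wilson expectation has vanishing weight integral**: the normalisation `Z⁻¹` of
the Wilson state of a continuous representation is a non-zero real number. [folklore] -/
theorem integral_weight_mul_eq_zero (hρ : Continuous ρ) (β : ℝ) {Ψ : GaugeConfig d L G → ℂ}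
    (h : wilsonExpectation ρ β Ψ = 0) :
    ∫ U, (Real.exp (-β * wilsonAction ρ U) : ℂ) * Ψ U
      ∂(LatticeRP.piMeasure (ι := Edge d L) (haarProbability G)) = 0 := by
  have hdens : Measurable fun U : GaugeConfig d L G => ENNReal.ofReal (Real.exp (-β * wilsonAction ρ U)) :=
    ENNReal.measurable_ofReal.comp ((WilsonRP.measurable_wilsonAction ρ hρ).const_mul (-β)).exp
  have key : ∀ Φ : GaugeConfig d L G → ℂ, wilsonExpectation ρ β Φ =
      (((partitionFunction (d := d) (L := L) ρ β)⁻¹).toReal : ℂ) *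
        ∫ U, (Real.exp (-β * wilsonAction ρ U) : ℂ) * Φ U
          ∂(LatticeRP.piMeasure (ι := Edge d L) (haarProbability G)) := by
    intro Φ
    unfold wilsonExpectation wilsonMeasure
    rw [integral_smul_measure]
    unfold wilsonWeight
    rw [integral_withDensity_eq_integral_toReal_smul hdens (ae_of_all _ fun _ => ENNReal.ofReal_lt_top)]
    simp_rw [ENNReal.toReal_ofReal (Real.exp_nonneg _), Complex.real_smul]
  haveI := isProbabilityMeasure_wilsonMeasure (d := d) (L := L) ρ hρ β
  have h1 : wilsonExpectation ρ β (fun _ : GaugeConfig d L G => (1 : ℂ)) = 1 := by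
    unfold wilsonExpectation; rw [integral_const, probReal_univ, one_smul]
  rw [key] at h1 h
  have hc : (((partitionFunction (d := d) (L := L) ρ β)⁻¹).toReal : ℂ) ≠ 0 := by
    intro h0; rw [h0, zero_mul] at h1; exact zero_ne_one h1
  exact (mul_eq_zero.1 h).resolve_left hc

omit [Fact (1 < L)] in
/-- The complex slab functional of the centred plaquette observable is the real slab functional
times the shared half-weight. [folklore] -/
theorem integral_siteObs_eq_chiR (β : ℝ) (q : Plaquette d L) (m : ℝ) (V : GaugeConfig d L G) :
    ∫ W, WilsonSiteRP.siteObs ρ β (fun U => ((WilsonRP.plaqRe ρ U q - m : ℝ) : ℂ))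
        (LatticeRP.splice WilsonSiteRP.sitePosEdges (V, W))
        ∂(LatticeRP.piMeasure (ι := Edge d L) (haarProbability G)) =
      ((chiR ρ β q m V * Real.exp (β / 2 * WilsonSiteRP.sharedAction ρ V) : ℝ) : ℂ) := by
  have hS : ∀ W, WilsonSiteRP.sharedAction ρ (LatticeRP.splice WilsonSiteRP.sitePosEdges (V, W)) =
      WilsonSiteRP.sharedAction ρ V := fun W =>
    WilsonSiteRP.dependsOn_sharedAction ρ fun e he => by
      have : e ∉ (WilsonSiteRP.sitePosEdges : Finset (Edge d L)) :=
        Finset.disjoint_left.1 WilsonSiteRP.disjoint_sharedEdges_sitePosEdges (Finset.mem_coe.1 he)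
      simp only [LatticeRP.splice_apply, if_neg this]
  have hpt : ∀ W, WilsonSiteRP.siteObs ρ β (fun U => ((WilsonRP.plaqRe ρ U q - m : ℝ) : ℂ))
      (LatticeRP.splice WilsonSiteRP.sitePosEdges (V, W)) =
      ((((WilsonRP.plaqRe ρ (LatticeRP.splice WilsonSiteRP.sitePosEdges (V, W)) q - m) *
        Real.exp (β * WilsonSiteRP.sitePosAction ρ (LatticeRP.splice WilsonSiteRP.sitePosEdges (V, W)))) *
        Real.exp (β / 2 * WilsonSiteRP.sharedAction ρ V) : ℝ) : ℂ) := fun W => by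
    unfold WilsonSiteRP.siteObs
    rw [hS W, Real.exp_add]
    push_cast
    ring
  simp_rw [hpt]
  rw [integral_complex_ofReal, integral_mul_const]
  rfl

omit [Fact (1 < L)] in
/-- The four links of a spatial plaquette at time `1` are slice-one links. [folklore] -/
theorem edges_mem_sliceOneEdges {q : Plaquette d L} (hq : q.2.1.1 ≠ 0) (hqt : (q.1 0).val = 1) :
    (q.1, q.2.1.1) ∈ (sliceOneEdges : Finset (Edge d L)) ∧
      (q.1.shift q.2.1.1, q.2.1.2) ∈ (sliceOneEdges : Finset (Edge d L)) ∧
      (q.1.shift q.2.1.2, q.2.1.1) ∈ (sliceOneEdges : Finset (Edge d L)) ∧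
      (q.1, q.2.1.2) ∈ (sliceOneEdges : Finset (Edge d L)) := by
  have hj : q.2.1.2 ≠ 0 := WilsonRP.plaq_snd_ne_zero q
  refine ⟨?_, ?_, ?_, ?_⟩
  · rw [mem_sliceOneEdges]; exact ⟨hq, hqt⟩
  · rw [mem_sliceOneEdges, WilsonRP.val_shift_of_ne _ (Ne.symm hq)]; exact ⟨hj, hqt⟩
  · rw [mem_sliceOneEdges, WilsonRP.val_shift_of_ne _ hj.symm]; exact ⟨hq, hqt⟩
  · rw [mem_sliceOneEdges]; exact ⟨hj, hqt⟩

/-- **Strict reflection positivity for site-mirror plaquette pairs (even torus).** For a compact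
group `G ≠ 1` with a continuous faithful unitary representation `ρ`, `β > 0`, `L` even with
`L ≥ 4`, and a spatial plaquette `q` at time `1`, the covariance of `Re tr ρ(U_q)` with its site
mirror `Re tr ρ(U_{θ'q})` (time `−1`) under the Wilson measure is STRICTLY positive. [folklore] -/
theorem cov_negReflect_pair_pos (hL : Even L) (hL4 : 4 ≤ L) (hρ : Continuous ρ)
    (hinj : Function.Injective ρ) (hunit : ∀ g, ρ g ∈ Matrix.unitaryGroup (Fin N) ℂ)
    (hG : ∃ g : G, g ≠ 1) {β : ℝ} (hβ : 0 < β) {q : Plaquette d L} (hq : q.2.1.1 ≠ 0)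
    (hqt : (q.1 0).val = 1) :
    0 < wilsonExpectation ρ β (fun U : GaugeConfig d L G =>
          WilsonRP.plaqRe ρ U (q.1.negReflect, q.2) * WilsonRP.plaqRe ρ U q)
        - wilsonExpectation ρ β (fun U : GaugeConfig d L G =>
            WilsonRP.plaqRe ρ U (q.1.negReflect, q.2))
          * wilsonExpectation ρ β (fun U : GaugeConfig d L G => WilsonRP.plaqRe ρ U q) := by
  classical
  haveI := isProbabilityMeasure_wilsonMeasure (d := d) (L := L) ρ hρ β
  have h1q : 1 ≤ (q.1 0).val := by rw [hqt]
  have h2q : (q.1 0).val < L / 2 := by rw [hqt]; omega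
  have hnn := AxisCovNonneg.cov_negReflect_pair_nonneg ρ hL hρ β hq h1q h2q
  refine lt_of_le_of_ne hnn fun hcov => ?_
  haveI hT2 : T2Space G := (hρ.isClosedEmbedding hinj).isEmbedding.t2Space
  haveI hSC : SecondCountableTopology G :=
    haveI : SecondCountableTopology (Matrix (Fin N) (Fin N) ℂ) :=
      inferInstanceAs (SecondCountableTopology (Fin N → Fin N → ℂ))
    (hρ.isClosedEmbedding hinj).isEmbedding.secondCountableTopology
  haveI : (haarProbability G).IsOpenPosMeasure := by unfold haarProbability; infer_instance
  set μ : Measure (GaugeConfig d L G) := LatticeRP.piMeasure (ι := Edge d L) (haarProbability G)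
    with hμ
  set ν : Measure (GaugeConfig d L G) := wilsonMeasure (d := d) (L := L) ρ β with hν
  set m : ℝ := ∫ U, WilsonRP.plaqRe ρ U q ∂ν with hm
  have hrefl : ∀ U : GaugeConfig d L G, WilsonRP.plaqRe ρ U.negReflect q =
      WilsonRP.plaqRe ρ U (q.1.negReflect, q.2) := fun U => by
    rw [WilsonSiteRP.plaqRe_negReflect ρ hρ U q, AxisCovNonneg.sitePlaqReflect_of_ne hq]
  have hPm : Measurable fun U : GaugeConfig d L G => WilsonRP.plaqRe ρ U q :=
    WilsonRP.measurable_plaqRe ρ hρ q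
  have hPb : ∀ U : GaugeConfig d L G, |WilsonRP.plaqRe ρ U q| ≤ N := fun U =>
    WilsonRP.abs_plaqRe_le ρ hρ U q
  have hPΘm : Measurable fun U : GaugeConfig d L G => WilsonRP.plaqRe ρ U.negReflect q :=
    hPm.comp WilsonSiteRP.measurable_negReflect
  have hbd : ∀ U : GaugeConfig d L G, ‖WilsonRP.plaqRe ρ U q‖ ≤ N := fun U => by
    rw [Real.norm_eq_abs]; exact hPb U
  have iP : Integrable (fun U => WilsonRP.plaqRe ρ U q) ν :=
    Integrable.of_bound hPm.aestronglyMeasurable N (ae_of_all _ hbd)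
  have iPΘ : Integrable (fun U : GaugeConfig d L G => WilsonRP.plaqRe ρ U.negReflect q) ν :=
    Integrable.of_bound hPΘm.aestronglyMeasurable N (ae_of_all _ fun U => hbd _)
  have iprod : Integrable (fun U : GaugeConfig d L G =>
      WilsonRP.plaqRe ρ U.negReflect q * WilsonRP.plaqRe ρ U q) ν :=
    Integrable.of_bound (hPΘm.mul hPm).aestronglyMeasurable (N * N) (ae_of_all _ fun U => by
      rw [norm_mul]; exact mul_le_mul (hbd _) (hbd _) (norm_nonneg _) (Nat.cast_nonneg _))
  have hEΘ : ∫ U, WilsonRP.plaqRe ρ U.negReflect q ∂ν = m :=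
    FiniteSusceptibilityWeakCoupling.RPCauchySchwarz.integral_comp_eq WilsonSiteRP.measurable_negReflect
      (WilsonSiteRP.wilsonMeasure_map_negReflect ρ hL hρ β) hPm
  have hcov' : ∫ U, WilsonRP.plaqRe ρ U.negReflect q * WilsonRP.plaqRe ρ U q ∂ν - m * m = 0 := by
    have h := hcov
    simp only [wilsonExpectation, ← hrefl] at h
    rw [hEΘ] at h
    linarith
  have hcentred : ∫ U, (WilsonRP.plaqRe ρ U.negReflect q - m) * (WilsonRP.plaqRe ρ U q - m) ∂ν = 0 := by
    have hexp : (fun U : GaugeConfig d L G =>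
        (WilsonRP.plaqRe ρ U.negReflect q - m) * (WilsonRP.plaqRe ρ U q - m)) =
        fun U => (WilsonRP.plaqRe ρ U.negReflect q * WilsonRP.plaqRe ρ U q - m * WilsonRP.plaqRe ρ U q) -
          (m * WilsonRP.plaqRe ρ U.negReflect q - m * m) := by
      funext U; ring
    have i1 : Integrable (fun U : GaugeConfig d L G =>
        WilsonRP.plaqRe ρ U.negReflect q * WilsonRP.plaqRe ρ U q - m * WilsonRP.plaqRe ρ U q) ν :=
      iprod.sub (iP.const_mul m)
    have i2 : Integrable (fun U : GaugeConfig d L G =>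
        m * WilsonRP.plaqRe ρ U.negReflect q - m * m) ν := (iPΘ.const_mul m).sub (integrable_const _)
    rw [hexp, integral_sub i1 i2, integral_sub iprod (iP.const_mul m),
      integral_sub (iPΘ.const_mul m) (integrable_const _), integral_const_mul, integral_const_mul, hEΘ,
      integral_const, probReal_univ, one_smul, ← hm]
    linarith
  set Fc : GaugeConfig d L G → ℂ := fun U => ((WilsonRP.plaqRe ρ U q - m : ℝ) : ℂ) with hFc
  have hC : wilsonExpectation ρ β (fun U => conj (Fc U.negReflect) * Fc U) = 0 := by
    unfold wilsonExpectation
    simp only [hFc, Complex.conj_ofReal, ← Complex.ofReal_mul]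
    rw [integral_complex_ofReal, hcentred, Complex.ofReal_zero]
  have hW := integral_weight_mul_eq_zero ρ hρ β hC
  have hFm : Measurable Fc := Complex.measurable_ofReal.comp (hPm.sub_const m)
  have hFb : ∀ U, ‖Fc U‖ ≤ N + |m| := fun U => by
    simp only [hFc, Complex.norm_real, Real.norm_eq_abs]
    exact (abs_sub _ _).trans (add_le_add (hPb U) le_rfl)
  have hFdep : DependsOn Fc ((WilsonSiteRP.sitePosEdges ∪ WilsonSiteRP.sharedEdges :
      Finset (Edge d L)) : Set (Edge d L)) := fun U U' hUU' => by
    have h := AxisCovNonneg.dependsOn_plaqRe_sub_sitePos ρ hq h1q h2q m hUU'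
    dsimp only at h
    simp only [hFc, h]
  have hRP := integral_siteRP_eq ρ hL hρ β hFm hFb hFdep
  rw [hW] at hRP
  set χ : GaugeConfig d L G → ℂ := fun V =>
    ∫ W, WilsonSiteRP.siteObs ρ β Fc (LatticeRP.splice WilsonSiteRP.sitePosEdges (V, W)) ∂μ with hχ
  have hχχ : ∫ V, χ V * conj (χ V) ∂μ = 0 := by
    have hexp : (Real.exp (-β * (N * Fintype.card (Plaquette d L))) : ℂ) ≠ 0 :=
      Complex.ofReal_ne_zero.2 (Real.exp_pos _).ne'
    exact (mul_eq_zero.1 hRP.symm).resolve_left hexp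
  have hnorm : ∫ V, ‖χ V‖ ^ 2 ∂μ = 0 := by
    have hpt : ∀ V, χ V * conj (χ V) = ((‖χ V‖ ^ 2 : ℝ) : ℂ) := fun V => by
      rw [Complex.mul_conj, Complex.normSq_eq_norm_sq]
    simp_rw [hpt] at hχχ
    rw [integral_complex_ofReal] at hχχ
    exact_mod_cast hχχ
  have hobs_c : Continuous (WilsonSiteRP.siteObs ρ β Fc : GaugeConfig d L G → ℂ) := by
    have hA : Continuous (WilsonSiteRP.sitePosAction (d := d) (L := L) (G := G) ρ) := by
      unfold WilsonSiteRP.sitePosAction; exact continuous_sum_plaqRe ρ hρ _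
    have hM : Continuous (WilsonSiteRP.sharedAction (d := d) (L := L) (G := G) ρ) := by
      unfold WilsonSiteRP.sharedAction; exact continuous_sum_plaqRe ρ hρ _
    unfold WilsonSiteRP.siteObs
    exact (Complex.continuous_ofReal.comp ((continuous_plaqRe ρ hρ q).sub continuous_const)).mul
      (Complex.continuous_ofReal.comp (Real.continuous_exp.comp
        ((continuous_const.mul hA).add (continuous_const.mul hM))))
  have hχc : Continuous χ := by
    have h := continuous_parametric_integral_of_continuous (μ := μ)
      (f := fun (V W : GaugeConfig d L G) =>
        WilsonSiteRP.siteObs ρ β Fc (LatticeRP.splice WilsonSiteRP.sitePosEdges (V, W)))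
      (hobs_c.comp (continuous_splice _)) isCompact_univ
    simpa only [Measure.restrict_univ] using h
  set Cobs : ℝ := |((N : ℝ) + |m|)| * Real.exp ((|β| + |β / 2|) * (N * Fintype.card (Plaquette d L)))
    with hCobs
  have hχb : ∀ V, ‖χ V‖ ≤ Cobs := fun V => by
    have h := norm_integral_le_of_norm_le_const (μ := μ) (ae_of_all _ fun W =>
      WilsonSiteRP.norm_siteObs_le ρ hρ β hFb (LatticeRP.splice WilsonSiteRP.sitePosEdges (V, W)))
    rwa [probReal_univ, mul_one] at h
  have hχ0 : ∀ V, χ V = 0 := by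
    have hg_c : Continuous fun V => ‖χ V‖ ^ 2 := (hχc.norm).pow 2
    have hg_i : Integrable (fun V => ‖χ V‖ ^ 2) μ := by
      refine Integrable.of_bound hg_c.measurable.aestronglyMeasurable (Cobs ^ 2)
        (ae_of_all _ fun V => ?_)
      rw [Real.norm_eq_abs, abs_of_nonneg (by positivity)]
      exact pow_le_pow_left₀ (norm_nonneg _) (hχb V) 2
    have hae : (fun V => ‖χ V‖ ^ 2) =ᵐ[μ] 0 :=
      (integral_eq_zero_iff_of_nonneg (fun V => by positivity) hg_i).1 hnorm
    have hfun : (fun V => ‖χ V‖ ^ 2) = 0 := (Continuous.ae_eq_iff_eq μ hg_c continuous_const).1 hae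
    intro V
    have := congr_fun hfun V
    simpa using this
  have hchiR : ∀ V, chiR ρ β q m V = 0 := fun V => by
    have h := integral_siteObs_eq_chiR ρ β q m V
    have h0 : χ V = 0 := hχ0 V
    simp only [hχ] at h0
    rw [h0] at h
    have h' : chiR ρ β q m V * Real.exp (β / 2 * WilsonSiteRP.sharedAction ρ V) = 0 := by
      exact_mod_cast h.symm
    exact (mul_eq_zero.1 h').resolve_right (Real.exp_pos _).ne'
  have h0 : ∀ A : GaugeConfig d L G, ∫ W, (WilsonRP.plaqRe ρ W q - m) * restWeight ρ β W *
      sliceKernel ρ β sliceOneEdges A W ∂μ = 0 := by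
    intro A
    have h := hchiR (bottomConfig A)
    rw [chiR_eq_integral_sliceKernel ρ hL4 hρ hunit hβ.le hq hqt m (bottomConfig A)] at h
    rw [← h]
    refine integral_congr_ae (ae_of_all _ fun W => ?_)
    dsimp only
    rw [sliceKernel_congr_left ρ (fun e he => (shiftDown_bottomConfig (A := A) he)) W]
    unfold restWeight
    rw [restAction_congr ρ hL4 (fun e he => (splice_bottomConfig_eq_of_val_ne_zero A W he))]
  obtain ⟨e1, e2, e3, e4⟩ := edges_mem_sliceOneEdges (d := d) (L := L) hq hqt
  have hsplc : Continuous fun W : GaugeConfig d L G =>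
      LatticeRP.splice WilsonSiteRP.sitePosEdges ((fun _ => (1 : G)), W) :=
    (continuous_splice _).comp (continuous_const.prodMk continuous_id)
  have hrc : Continuous (restWeight ρ β : GaugeConfig d L G → ℝ) :=
    Real.continuous_exp.comp (((continuous_sum_plaqRe ρ hρ _).comp hsplc).const_mul β)
  have hrm : Measurable (restWeight ρ β : GaugeConfig d L G → ℝ) :=
    (((measurable_sum_plaqRe ρ hρ _).comp ((LatticeRP.measurable_splice _).comp
      (measurable_const.prodMk measurable_id))).const_mul β).exp
  have hrb : ∀ W : GaugeConfig d L G, |restWeight ρ β W| ≤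
      Real.exp (β * (N * Fintype.card (Plaquette d L))) := fun W => by
    unfold restWeight
    rw [abs_of_pos (Real.exp_pos _)]
    refine Real.exp_le_exp.2 (mul_le_mul_of_nonneg_left ?_ hβ.le)
    exact (le_abs_self _).trans (abs_sum_plaqRe_le ρ hρ _ _)
  have hrpos : ∀ W : GaugeConfig d L G, 0 < restWeight ρ β W := fun W => Real.exp_pos _
  exact false_of_forall_integral_sliceKernel_eq_zero ρ hρ hinj hunit hG hβ sliceOneEdges q e1 e2 e3 e4
    (restWeight ρ β) hrc hrm hrb hrpos m h0

end Main

/-! ### The crux's reference pair on the even torus -/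

section CruxEven

variable {L N : ℕ} [NeZero L] {G : Type*} [Group G] [TopologicalSpace G] [IsTopologicalGroup G]
  [CompactSpace G] [MeasurableSpace G] [BorelSpace G] (ρ : G →* Matrix (Fin N) (Fin N) ℂ)

/-- **The crux's reference covariance at separation `2` is strictly positive (even torus).**
`Cov_{L,β}(P_0^{01}, P_{2e₂}^{01}) > 0` for `L` even, `L ≥ 4`, `β > 0`, `G ≠ 1`, `ρ` continuous
faithful unitary (strict site-mirror positivity transported to the crux's pair by the tree's
`cruxAxisCov_eq`, `negReflect_single`, `cov_translate`). [folklore] -/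
theorem cruxAxisCov_two_pos_of_even (hL : Even L) (hL4 : 4 ≤ L) (hρ : Continuous ρ)
    (hinj : Function.Injective ρ) (hunit : ∀ g, ρ g ∈ Matrix.unitaryGroup (Fin N) ℂ)
    (hG : ∃ g : G, g ≠ 1) {β : ℝ} (hβ : 0 < β) :
    0 < wilsonExpectation ρ β (fun U : GaugeConfig 4 L G =>
          ((N : ℝ) - (ρ (plaquetteHolonomy U 0 0 1)).trace.re) *
            ((N : ℝ) - (ρ (plaquetteHolonomy U
              (Pi.single (2 : Fin 4) (((2 : ℕ) : ℕ) : ZMod L)) 0 1)).trace.re))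
        - wilsonExpectation ρ β (fun U : GaugeConfig 4 L G =>
            (N : ℝ) - (ρ (plaquetteHolonomy U 0 0 1)).trace.re)
          * wilsonExpectation ρ β (fun U : GaugeConfig 4 L G =>
            (N : ℝ) - (ρ (plaquetteHolonomy U
              (Pi.single (2 : Fin 4) (((2 : ℕ) : ℕ) : ZMod L)) 0 1)).trace.re) := by
  haveI : Fact (1 < L) := ⟨by omega⟩
  rw [AxisCovNonneg.cruxAxisCov_eq ρ hρ β 2]
  set q12 : {p : Fin 4 × Fin 4 // p.1 < p.2} := ⟨((1 : Fin 4), (2 : Fin 4)), by decide⟩ with hq12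
  have hq : q12.1.1 ≠ 0 := by simp [hq12]
  have hval : ((Pi.single (0 : Fin 4) (1 : ZMod L) : Site 4 L) 0).val = 1 := by
    rw [Pi.single_eq_same, ZMod.val_one]
  have h := cov_negReflect_pair_pos (d := 4) (L := L) ρ hL hL4 hρ hinj hunit hG hβ
    (q := (((Pi.single (0 : Fin 4) (1 : ZMod L) : Site 4 L)), q12)) hq hval
  dsimp only at h
  rw [AxisCovNonneg.negReflect_single,
    AxisCovNonneg.cov_translate ρ β _ _ (Pi.single (0 : Fin 4) (-1 : ZMod L)) q12] at h
  have e1 : (Pi.single (0 : Fin 4) (-1 : ZMod L) : Site 4 L) - Pi.single (0 : Fin 4) (-1 : ZMod L) = 0 :=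
    sub_self _
  have e2 : (Pi.single (0 : Fin 4) (1 : ZMod L) : Site 4 L) - Pi.single (0 : Fin 4) (-1 : ZMod L) =
      Pi.single (0 : Fin 4) (((2 : ℕ) : ℕ) : ZMod L) := by
    rw [← Pi.single_sub]
    congr 1
    push_cast
    ring
  rw [e1, e2] at h
  exact h

/-- **The crux's reference covariance at separation `1` is strictly positive (even torus)**:
by the landed antitone axis profile (`axisPlaquetteCov_antitone`, `k = 1 ≤ n = 2`, `4 ≤ L`),
`Cov(P_0^{01}, P_{e₂}^{01}) ≥ Cov(P_0^{01}, P_{2e₂}^{01}) > 0`. [folklore] -/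
theorem cruxAxisCov_one_pos_of_even (hL : Even L) (hL4 : 4 ≤ L) (hρ : Continuous ρ)
    (hinj : Function.Injective ρ) (hunit : ∀ g, ρ g ∈ Matrix.unitaryGroup (Fin N) ℂ)
    (hG : ∃ g : G, g ≠ 1) {β : ℝ} (hβ : 0 < β) :
    0 < wilsonExpectation ρ β (fun U : GaugeConfig 4 L G =>
          ((N : ℝ) - (ρ (plaquetteHolonomy U 0 0 1)).trace.re) *
            ((N : ℝ) - (ρ (plaquetteHolonomy U
              (Pi.single (2 : Fin 4) (((1 : ℕ) : ℕ) : ZMod L)) 0 1)).trace.re))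
        - wilsonExpectation ρ β (fun U : GaugeConfig 4 L G =>
            (N : ℝ) - (ρ (plaquetteHolonomy U 0 0 1)).trace.re)
          * wilsonExpectation ρ β (fun U : GaugeConfig 4 L G =>
            (N : ℝ) - (ρ (plaquetteHolonomy U
              (Pi.single (2 : Fin 4) (((1 : ℕ) : ℕ) : ZMod L)) 0 1)).trace.re) :=
  lt_of_lt_of_le (cruxAxisCov_two_pos_of_even ρ hL hL4 hρ hinj hunit hG hβ)
    (AxisCovNonneg.axisPlaquetteCov_antitone ρ hρ hβ.le (k := 1) (n := 2) (by norm_num) (by omega))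

end CruxEven

/-- **Registered sub-goal `stub_axisPositive_even`** (`--supports stmt-QuantumFields-9363`): the crux's reference axis covariance `Cov_{L,β}(P_0^{01}, P_{e₂}^{01})` is STRICTLY positive for every even `L ≥ 4`, every `β > 0`, every compact `G ≠ 1` and every continuous faithful unitary `ρ` (even half of `stub_axisPositive`; closed form of `cruxAxisCov_one_pos_of_even`). [folklore] -/
theorem stub_axisPositive_even : ∀ (L N : ℕ) [NeZero L] (G : Type) [Group G] [TopologicalSpace G] [IsTopologicalGroup G] [CompactSpace G] [MeasurableSpace G] [BorelSpace G] (ρ : G →* Matrix (Fin N) (Fin N) ℂ), Even L → 4 ≤ L → Continuous ρ → Function.Injective ρ → (∀ g, ρ g ∈ Matrix.unitaryGroup (Fin N) ℂ) → (∃ g : G, g ≠ 1) → ∀ (β : ℝ), 0 < β → 0 < Literature.MathematicalPhysics.QuantumFieldTheory.wilsonExpectation ρ β (fun U : Literature.MathematicalPhysics.QuantumFieldTheory.GaugeConfig 4 L G => ((N : ℝ) - (ρ (Literature.MathematicalPhysics.QuantumFieldTheory.plaquetteHolonomy U 0 0 1)).trace.re) * ((N : ℝ) - (ρ (Literature.MathematicalPhysics.QuantumFieldTheory.plaquetteHolonomy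 U (Pi.single (2 : Fin 4) (((1 : ℕ) : ℕ) : ZMod L)) 0 1)).trace.re)) - Literature.MathematicalPhysics.QuantumFieldTheory.wilsonExpectation ρ β (fun U : Literature.MathematicalPhysics.QuantumFieldTheory.GaugeConfig 4 L G => (N : ℝ) - (ρ (Literature.MathematicalPhysics.QuantumFieldTheory.plaquetteHolonomy U 0 0 1)).trace.re) * Literature.MathematicalPhysics.QuantumFieldTheory.wilsonExpectation ρ β (fun U : Literature.MathematicalPhysics.QuantumFieldTheory.GaugeConfig 4 L G => (N : ℝ) - (ρ (Literature.MathematicalPhysics.QuantumFieldTheory.plaquetteHolonomy U (Pi.single (2 : Fin 4) (((1 : ℕ) : ℕ) : ZMod L)) 0 1)).trace.re) := by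
  intro L N _ G _ _ _ _ _ _ ρ hL hL4 hρ hinj hunit hG β hβ
  exact cruxAxisCov_one_pos_of_even ρ hL hL4 hρ hinj hunit hG hβ

end Summit.QuantumFields.YangMills.Theorems.FemtoCurvatureTwoPoint.StrictRP

end
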